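import Literature.NumberTheory.Automorphic.PlaneLatticesCompanionSelfDualCount        -- ★ p8413xx (β2′-ii) the level-0 count `Σ_{k ≤ N} q^k` and its §1 bijection
import Literature.NumberTheory.Automorphic.FixedCosetsLevelShift                    -- ★ B-p10 the level token `map_eq_self_and_level_iff_map_levelShift_le`
import Literature.NumberTheory.Automorphic.PlaneLatticesCompanionLevelHermite       -- ★-twin organs: `natCard_antifixed_mem_pow_eq`, `forall_valuation_sub_one_le_iff_of_hermite_companion`
import HarnessLib

/-!
# The LEVEL-`j` count of self-dual companion-stable plane lattices: `q^{k−k₀}` in the strata `k₀ ≤ k ≤ k₀ + (N − j)`, `k₀ = ⌈(j−e)∕2⌉`; total `Σ_{i ≤ N−j} q^i`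
# — the type-(2) H-side value `Φ_H(γ, 1_{K_H(j)}) = phiHtwo q (N − j)` (law C1 on the type-(2) torus)

Topic `NumberTheory/Automorphic`; namespace `Literature.NumberTheory.Automorphic`.  THEOREMS ONLY (no definition, no instance, no notation, no named fact,
no `sorry`).  Cell `pub/hodgecm-mathlib`, crux H413, road «S3-tree» brick **T6-2** (H-side germ table, type-(2) rows; architect A-59 (2) «=» on Route A; END∕T6 holder
F0P3a-p03 (g14)).  HC_CM is proved only modulo the cell's 2 remaining named inputs (hLiu418, h413) until rung 0 closes; this file is unconditional and elementary.

THE COUNT.  Frame of ★ (β2′-ii): `C = !![0, −d; 1, t]`, `|d| = 1`, `t ∈ 𝒪`, `|t² − 4d| = |ϖ|^{2N+1}`, form `!![0, β; σβ, 0]`, `|β| = |ϖ|^e`, `e ≤ 1`, `|2| = 1`.  In the stratum `k`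
(Hermite exponents `(k, −k−e)`, `y = (z − ϖ^{−(k+e)}t)∕2`, `z ∈ 𝒪` mod `ϖ^k`) the entries of `T⁻¹ C T − 1` are (★ `upperTriangular_inv_mul_companion_mul`)
`−y′ − 1`, `y′ + t − 1`, `ϖ^{2k+e}`, `−ϖ^{−(2k+e)}(y′² + t y′ + d)` with `y′ = ϖ^{k+e} y`, `2y′ + t = ϖ^{k+e} z`.  For `γ` DEEP (`|t − 2| ≤ |ϖ^j|`) the level-`j` condition
«all entries `≡ 0 (mod ϖ^j)`» reads: `2k + e ≥ j`, `|ϖ^{k+e} z| ≤ |ϖ^j|`, and `min(2k + 2e + 2v(z), 2N+1) ≥ 2k + e + j` (odd∕even valuations, as in ★ `norm_condition_iff`), i.e.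
**`k₀ ≤ k ≤ k₀ + (N − j)` and `z ∈ 𝔪^{k₀}`, `k₀ := ⌈(j − e)∕2⌉`** (all four parities of `(j, e)`).  So the level-`j` part of the stratum `k` is in bijection with the anti-fixed
classes of `𝔪^{k₀} ⧸ 𝔪^{k} ≅ 𝒪 ⧸ 𝔪^{k−k₀}` (organ file: `natCard_antifixed_mem_pow_eq`, level criterion `forall_valuation_sub_one_le_iff_of_hermite_companion`), which number `q^{k−k₀}`; summing, `#S_j = Σ_{i=0}^{N−j} q^i = phiHtwo q (N − j)`, the
value of law C1 («`Φ^κ(γ, 1_{K(j)}) = Φ^κ(γ^{(−j)}, 1_K)`», T0 ADDENDUM-2) on the type-(2) torus, since the depth of `γ` drops from `N` to `N − j`.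

* §1 `ncard_stratum_level_antidiag_companion_eq` — the level-`j` part of the stratum `k ≤ N`: `q^{k−k₀}` if `k₀ ≤ k ≤ k₀ + (N − j)`, else `0`.
* §2 `ncard_selfDualStable_level_antidiag_companion_eq_sum` — `#S_j(!![0, β; σβ, 0], C(t,d)) = Σ_{i ∈ range (N−j+1)} q^i`.

## References
* [Serre1979] J.-P. Serre, *Local Fields*, GTM 67 (1979), Ch. V §2.
* [Flicker1998UnitaryFL] Y. Z. Flicker, *Elementary proof of the fundamental lemma for a unitary group*, Canad. J. Math. 50 (1998), §6 p. 97.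
* [Rogawski1990] J. Rogawski, *Automorphic representations of unitary groups in three variables* (1990), §4.9, §12.2 (germs near the identity).
* [Serre1980Trees] J.-P. Serre, *Trees* (1980), Ch. II §1.1–1.2.
-/

set_option autoImplicit false

noncomputable section

open scoped ValuativeRel Matrix MatrixGroups
open Matrix ValuativeRel Finset IsLocalRing

namespace Literature.NumberTheory.Automorphic

variable {F : Type*} [Field F] [ValuativeRel F] {ϖ : F} (hϖ : IsUniformizingElement ϖ) (σ : F →+* F)
  [IsDiscreteValuationRing 𝒪[F]]
  (σO : 𝒪[F] →+* 𝒪[F]) (hσO' : ∀ x : 𝒪[F], ((σO x : 𝒪[F]) : F) = σ x) (hσσ : ∀ x, σO (σO x) = x)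
  (hσϖ : σ ϖ = ϖ) (hσv : ∀ x, valuation F (σ x) = valuation F x) (h2 : valuation F 2 = 1)
  {t d β : F} (ht : t ∈ 𝒪[F]) (hd : valuation F d = 1) {e : ℕ} (he : e ≤ 1) (hβ : valuation F β = valuation F (ϖ ^ e))
  {N : ℕ} (hD : valuation F (t ^ 2 - 4 * d) = valuation F (ϖ ^ (2 * N + 1))) (htr : β * σ t + σ β * t = 0)
  (γ : GL (Fin 2) F) (hγ : (γ : Matrix (Fin 2) (Fin 2) F) = !![0, -d; 1, t])
  {j : ℕ} (hj : 1 ≤ j) (hjN : j ≤ N) (ht2 : valuation F (t - 2) ≤ valuation F (ϖ ^ j))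


/-! ## §1 The level-`j` part of the stratum `k` -/

include hϖ hσO' hσσ hσϖ hσv h2 ht hd he hβ hD htr hγ hj ht2 in
/-- **THE LEVEL-`j` PART OF THE STRATUM `k ≤ N`**: among the self-dual `C`-stable Hermite lattices `Λ(T(k, y, −k−e))`, those on which `C` acts at level `j`
(`(1 + ϖ^{−j}(C − 1))Λ ⊆ Λ`) number `q^{k − k₀}` if `k₀ ≤ k ≤ k₀ + (N − j)` (`k₀ = ⌈(j−e)∕2⌉`) and `0` otherwise (`γ` deep: `|t − 2| ≤ |ϖ^j|`).
[cite: Flicker1998UnitaryFL, §6 p. 97] [cite: Rogawski1990, §4.9] -/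
theorem ncard_stratum_level_antidiag_companion_eq {q : ℕ} [Finite (ResidueField 𝒪[F])]
    (hq : Nat.card (ResidueField 𝒪[F]) = q ^ 2) {a₀ : 𝒪[F]} (ha₀ : IsUnit (σO a₀ - a₀)) {k : ℕ} (hk : k ≤ N) :
    {Λ : Submodule 𝒪[F] (Fin 2 → F) | ∃ (y : F) (g : GL (Fin 2) F), (g : Matrix (Fin 2) (Fin 2) F) = !![ϖ ^ (k : ℤ), y; 0, ϖ ^ (-(k : ℤ) - e)] ∧
        (∃ J' ∈ glInt 2 F, (J' : Matrix (Fin 2) (Fin 2) F) = formCongr σ g (!![0, β; σ β, 0] : Matrix (Fin 2) (Fin 2) F)) ∧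
        (Submodule.span 𝒪[F] (Set.range ((g : Matrix (Fin 2) (Fin 2) F))ᵀ)).map ((Matrix.toLin' (γ : Matrix (Fin 2) (Fin 2) F)).restrictScalars 𝒪[F]) =
          Submodule.span 𝒪[F] (Set.range ((g : Matrix (Fin 2) (Fin 2) F))ᵀ) ∧
        (Submodule.span 𝒪[F] (Set.range ((g : Matrix (Fin 2) (Fin 2) F))ᵀ)).map
            ((Matrix.toLin' (1 + (ϖ ^ j)⁻¹ • ((γ : Matrix (Fin 2) (Fin 2) F) - 1))).restrictScalars 𝒪[F]) ≤
          Submodule.span 𝒪[F] (Set.range ((g : Matrix (Fin 2) (Fin 2) F))ᵀ) ∧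
        Λ = Submodule.span 𝒪[F] (Set.range ((g : Matrix (Fin 2) (Fin 2) F))ᵀ)}.ncard =
      if (j - e + 1) / 2 ≤ k ∧ k + j ≤ (j - e + 1) / 2 + N then q ^ (k - (j - e + 1) / 2) else 0 := by
  classical
  have h0 := hϖ.ne_zero
  have h20 : (2 : F) ≠ 0 := fun h => by rw [h, map_zero] at h2; exact zero_ne_one h2
  have hσO : ∀ x : 𝒪[F], σ x ∈ 𝒪[F] := fun x => by rw [← hσO' x]; exact (σO x).2
  have hσσF : ∀ x : 𝒪[F], σ (σ (x : F)) = x := fun x => by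
    have := congrArg (fun y : 𝒪[F] => (y : F)) (hσσ x); rwa [hσO', hσO'] at this
  have hdetT : ∀ y : F, (!![ϖ ^ (k : ℤ), y; 0, ϖ ^ (-(k : ℤ) - e)] : Matrix (Fin 2) (Fin 2) F).det ≠ 0 := fun y => by
    rw [Matrix.det_fin_two_of, mul_zero, sub_zero]; exact mul_ne_zero (zpow_ne_zero _ h0) (zpow_ne_zero _ h0)
  -- the unit `u = σ(β₁)`, `β₁ = ϖ^{-e} β ∈ 𝒪^×`
  have hβ1v : valuation F (ϖ ^ (-(e : ℤ)) * β) = 1 := by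
    rw [map_mul, hβ, ← map_mul, ← zpow_natCast, ← zpow_add₀ h0, neg_add_cancel, zpow_zero, map_one]
  have hβ1O : ϖ ^ (-(e : ℤ)) * β ∈ 𝒪[F] := (Valuation.mem_integer_iff _ _).2 hβ1v.le
  have hβ0 : β ≠ 0 := fun h => by rw [h, mul_zero, map_zero] at hβ1v; exact zero_ne_one hβ1v
  have hσβ0 : σ β ≠ 0 := (map_ne_zero σ).2 hβ0
  set u : F := σ (ϖ ^ (-(e : ℤ)) * β) with hu
  have hue : u = ϖ ^ (-(e : ℤ)) * σ β := by rw [hu, map_mul, map_zpow₀, hσϖ]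
  have huv : valuation F u = 1 := by rw [hu, hσv]; exact hβ1v
  have hu0 : u ≠ 0 := fun h => by rw [h, map_zero] at huv; exact zero_ne_one huv
  have huO : u ∈ 𝒪[F] := (Valuation.mem_integer_iff _ _).2 huv.le
  have huiO : u⁻¹ ∈ 𝒪[F] := (Valuation.mem_integer_iff _ _).2 (by rw [map_inv₀, huv, inv_one])
  have hσu : σ u = ϖ ^ (-(e : ℤ)) * β := by rw [hu]; exact hσσF ⟨_, hβ1O⟩
  have hσ2 : σ (2 : F)⁻¹ = 2⁻¹ := by rw [map_inv₀, map_ofNat]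
  have h2i : (2 : F)⁻¹ ∈ 𝒪[F] := (Valuation.mem_integer_iff _ _).2 (by rw [map_inv₀, h2, inv_one])
  -- the parametrisation `x ↦ y(x) = (u⁻¹ x − ϖ^{−(k+e)} t) / 2`
  set yOf : F → F := fun x => (u⁻¹ * x - ϖ ^ (-((k + e : ℕ) : ℤ)) * t) * 2⁻¹ with hyOf
  -- (F1) `y′ = ϖ^{k+e} y` and `ϖ^{-(k+e)}(2y′ + t) = u⁻¹ x`
  have hF1 : ∀ x : F, ϖ ^ (-((k + e : ℕ) : ℤ)) * (2 * (ϖ ^ (-(-(k : ℤ) - e)) * yOf x) + t) = u⁻¹ * x := fun x => by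
    rw [hyOf]
    have : (ϖ : F) ^ (-(-(k : ℤ) - e)) = (ϖ ^ (-((k + e : ℕ) : ℤ)))⁻¹ := by rw [← _root_.zpow_neg]; congr 1; push_cast; ring
    rw [this]; field_simp; ring
  have hF1' : ∀ x : F, x ∈ 𝒪[F] → ϖ ^ (-(-(k : ℤ) - e)) * yOf x ∈ 𝒪[F] := fun x hx => by
    have : ϖ ^ (-(-(k : ℤ) - e)) * yOf x = (ϖ ^ ((k + e : ℕ) : ℤ) * (u⁻¹ * x) - t) * 2⁻¹ := by
      rw [hyOf]
      have e1 : (ϖ : F) ^ (-(-(k : ℤ) - e)) = ϖ ^ ((k + e : ℕ) : ℤ) := by congr 1; push_cast; ring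
      have e2 : (ϖ : F) ^ ((k + e : ℕ) : ℤ) * ϖ ^ (-((k + e : ℕ) : ℤ)) = 1 := by rw [← zpow_add₀ h0, add_neg_cancel, zpow_zero]
      rw [e1]
      calc ϖ ^ ((k + e : ℕ) : ℤ) * ((u⁻¹ * x - ϖ ^ (-((k + e : ℕ) : ℤ)) * t) * 2⁻¹)
          = (ϖ ^ ((k + e : ℕ) : ℤ) * (u⁻¹ * x) - (ϖ ^ ((k + e : ℕ) : ℤ) * ϖ ^ (-((k + e : ℕ) : ℤ))) * t) * 2⁻¹ := by ring
        _ = _ := by rw [e2, one_mul]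
    rw [this]
    exact (𝒪[F]).mul_mem ((𝒪[F]).sub_mem ((𝒪[F]).mul_mem ((zpow_uniformizer_mem_integer_iff hϖ _).2 (by positivity))
      ((𝒪[F]).mul_mem huiO hx)) ht) h2i
  -- (F2) the trace expression: `β σy + σβ y = ϖ^e (x + σx) / 2`
  have hF2 : ∀ x : F, β * σ (yOf x) + σ β * yOf x = ϖ ^ (e : ℤ) * (x + σ x) * 2⁻¹ := fun x => by
    rw [hyOf]
    simp only [map_mul, map_sub, map_inv₀, hσu, map_zpow₀, hσϖ, hσ2]
    rw [hue]
    have hβi : (ϖ ^ (-(e : ℤ)) * β)⁻¹ = ϖ ^ (e : ℤ) * β⁻¹ := by rw [mul_inv, ← _root_.zpow_neg, neg_neg]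
    have hσβi : (ϖ ^ (-(e : ℤ)) * σ β)⁻¹ = ϖ ^ (e : ℤ) * (σ β)⁻¹ := by rw [mul_inv, ← _root_.zpow_neg, neg_neg]
    rw [hβi, hσβi]
    have htr' : σ β * t = -(β * σ t) := by linear_combination htr
    field_simp
    linear_combination (- ϖ ^ (-((k + e : ℕ) : ℤ))) * htr
  -- (F3) for `x ∈ 𝒪`: the lattice `Λ(T(k, y(x), −k−e))` is `C`-stable, and self-dual iff `x̄` is anti-fixed
  have hF3st : ∀ (x : F) (hx : x ∈ 𝒪[F]) (g : GL (Fin 2) F), (g : Matrix (Fin 2) (Fin 2) F) = !![ϖ ^ (k : ℤ), yOf x; 0, ϖ ^ (-(k : ℤ) - e)] →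
      (Submodule.span 𝒪[F] (Set.range ((g : Matrix (Fin 2) (Fin 2) F))ᵀ)).map ((Matrix.toLin' (γ : Matrix (Fin 2) (Fin 2) F)).restrictScalars 𝒪[F]) =
        Submodule.span 𝒪[F] (Set.range ((g : Matrix (Fin 2) (Fin 2) F))ᵀ) := fun x hx g hg => by
    refine (map_companion_span_eq_self_iff_of_hermite hϖ γ g hγ hd ht hg).2 ⟨by omega, hF1' x hx, ?_⟩
    rw [(companion_rescale_identities h0 (k := k) (e := e) rfl (yOf x) t d β (σ β) (σ (yOf x))).1]
    exact (norm_condition_iff hϖ h2 ht hD he (hF1' x hx)).2 ⟨hk, by rw [hF1 x]; exact (𝒪[F]).mul_mem huiO hx⟩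
  have hF3sd : ∀ (x : 𝒪[F]) (g : GL (Fin 2) F), (g : Matrix (Fin 2) (Fin 2) F) = !![ϖ ^ (k : ℤ), yOf x; 0, ϖ ^ (-(k : ℤ) - e)] →
      ((∃ J' ∈ glInt 2 F, (J' : Matrix (Fin 2) (Fin 2) F) = formCongr σ g (!![0, β; σ β, 0] : Matrix (Fin 2) (Fin 2) F)) ↔
        (Ideal.quotientMap (maximalIdeal 𝒪[F] ^ k) σO (LocalFields.UnramifiedQuadraticNorm.maximalIdeal_pow_le_comap σO hσσ k)) (Ideal.Quotient.mk (maximalIdeal 𝒪[F] ^ k) x) = -Ideal.Quotient.mk (maximalIdeal 𝒪[F] ^ k) x) := fun x g hg => by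
    rw [exists_mem_glInt_coe_eq_formCongr_hermite_antidiag_iff σ hϖ hσϖ hσv g hg]
    have hv1 : valuation F (β * ϖ ^ ((k : ℤ) + (-(k : ℤ) - e))) = 1 := by
      rw [show (k : ℤ) + (-(k : ℤ) - e) = -(e : ℤ) by ring, mul_comm]; exact hβ1v
    simp only [hv1, true_and]
    rw [hF2]
    -- `ϖ^{-k-e} (ϖ^e (x + σx) / 2) = ϖ^{-k} (x + σx) · 2⁻¹`
    have e1 : (ϖ : F) ^ (-(k : ℤ) - e) * (ϖ ^ (e : ℤ) * ((x : F) + σ x) * 2⁻¹) = (ϖ ^ (-(k : ℤ)) * (((x + σO x : 𝒪[F]) : F) - ((0 : 𝒪[F]) : F))) * 2⁻¹ := by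
      rw [Subring.coe_add, hσO', Subring.coe_zero, sub_zero, show (-(k : ℤ) - e) = -(k : ℤ) + -(e : ℤ) by ring, zpow_add₀ h0]
      have : (ϖ : F) ^ (-(e : ℤ)) * ϖ ^ (e : ℤ) = 1 := by rw [← zpow_add₀ h0, neg_add_cancel, zpow_zero]
      calc ϖ ^ (-(k : ℤ)) * ϖ ^ (-(e : ℤ)) * (ϖ ^ (e : ℤ) * ((x : F) + σ x) * 2⁻¹)
          = ϖ ^ (-(k : ℤ)) * (ϖ ^ (-(e : ℤ)) * ϖ ^ (e : ℤ)) * ((x : F) + σ x) * 2⁻¹ := by ring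
        _ = _ := by rw [this, mul_one]
    rw [e1]
    -- `w · 2⁻¹ ∈ 𝒪 ↔ w ∈ 𝒪` (`|2| = 1`)
    have h2u : ∀ w : F, w * 2⁻¹ ∈ 𝒪[F] ↔ w ∈ 𝒪[F] := fun w => by
      rw [Valuation.mem_integer_iff, Valuation.mem_integer_iff, map_mul, map_inv₀, h2, inv_one, mul_one]
    rw [h2u, zpow_neg_mul_coe_sub_mem_iff_mk_eq_mk hϖ k, map_zero, map_add, ← eq_neg_iff_add_eq_zero]
    -- `σk (mk x) = mk (σO x)`
    have : (Ideal.quotientMap (maximalIdeal 𝒪[F] ^ k) σO (LocalFields.UnramifiedQuadraticNorm.maximalIdeal_pow_le_comap σO hσσ k)) (Ideal.Quotient.mk (maximalIdeal 𝒪[F] ^ k) x) = Ideal.Quotient.mk (maximalIdeal 𝒪[F] ^ k) (σO x) := Ideal.quotientMap_mk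
    rw [this]
    constructor
    · intro h; rw [h, neg_neg]
    · intro h; rw [h, neg_neg]
  -- lifts of residue classes
  have hlift : ∀ x : 𝒪[F] ⧸ (maximalIdeal 𝒪[F] ^ k), ∃ z : 𝒪[F], Ideal.Quotient.mk (maximalIdeal 𝒪[F] ^ k) z = x := fun x => Ideal.Quotient.mk_surjective x
  choose lift hlift using hlift
  -- `y(a) − y(b) = u⁻¹ (a − b) / 2`
  have hydiff : ∀ a b : F, yOf a - yOf b = u⁻¹ * (a - b) * 2⁻¹ := fun a b => by rw [hyOf]; ring
  have hcongr : ∀ a b : 𝒪[F], ϖ ^ (-(k : ℤ)) * (yOf a - yOf b) ∈ 𝒪[F] ↔ Ideal.Quotient.mk (maximalIdeal 𝒪[F] ^ k) a = Ideal.Quotient.mk (maximalIdeal 𝒪[F] ^ k) b := fun a b => by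
    rw [← zpow_neg_mul_coe_sub_mem_iff_mk_eq_mk hϖ k, hydiff]
    constructor
    · intro h
      have : ϖ ^ (-(k : ℤ)) * ((a : F) - b) = (ϖ ^ (-(k : ℤ)) * (u⁻¹ * ((a : F) - b) * 2⁻¹)) * (u * 2) := by field_simp
      rw [this]
      exact (𝒪[F]).mul_mem h ((𝒪[F]).mul_mem huO ((Valuation.mem_integer_iff _ _).2 h2.le))
    · intro h
      have : ϖ ^ (-(k : ℤ)) * (u⁻¹ * ((a : F) - b) * 2⁻¹) = (ϖ ^ (-(k : ℤ)) * ((a : F) - b)) * (u⁻¹ * 2⁻¹) := by ring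
      rw [this]
      exact (𝒪[F]).mul_mem h ((𝒪[F]).mul_mem huiO h2i)
  -- the level token and its Hermite reading
  set k₀ : ℕ := (j - e + 1) / 2 with hk₀
  have hc0 : (ϖ : F) ^ j ≠ 0 := pow_ne_zero _ h0
  have hpos : ∀ z : ℤ, 0 < valuation F (ϖ ^ z) := fun z => (Valuation.pos_iff _).2 (zpow_ne_zero _ h0)
  have hc1 : valuation F (ϖ ^ j) < 1 := by
    rw [← zpow_natCast, ← not_le, show (1 : ValueGroupWithZero F) = valuation F (ϖ ^ (0 : ℤ)) by rw [zpow_zero, map_one],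
      valuation_zpow_le_valuation_zpow_iff hϖ]
    omega
  -- `|ϖ^{-n} z| ≤ 1 ↔ |z| ≤ |ϖ^n|`
  have key : ∀ (n : ℕ) (z : F), ϖ ^ (-(n : ℤ)) * z ∈ 𝒪[F] ↔ valuation F z ≤ valuation F (ϖ ^ (n : ℤ)) := fun n z => by
    rw [Valuation.mem_integer_iff, map_mul, _root_.zpow_neg, map_inv₀, ← div_eq_inv_mul, div_le_one₀ ((Valuation.pos_iff _).2 (zpow_ne_zero _ h0))]
  -- (F4) for `x ∈ 𝒪`: the level-`j` condition on `Λ(T(k, y(x), −k−e))` ↔ admissibility ∧ `x ∈ 𝔪^{k₀}`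
  have hF4 : ∀ (x : F) (hx : x ∈ 𝒪[F]) (g : GL (Fin 2) F), (g : Matrix (Fin 2) (Fin 2) F) = !![ϖ ^ (k : ℤ), yOf x; 0, ϖ ^ (-(k : ℤ) - e)] →
      ((Submodule.span 𝒪[F] (Set.range ((g : Matrix (Fin 2) (Fin 2) F))ᵀ)).map
            ((Matrix.toLin' (1 + (ϖ ^ j)⁻¹ • ((γ : Matrix (Fin 2) (Fin 2) F) - 1))).restrictScalars 𝒪[F]) ≤
          Submodule.span 𝒪[F] (Set.range ((g : Matrix (Fin 2) (Fin 2) F))ᵀ) ↔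
        (j ≤ 2 * k + e ∧ 2 * k + e + j ≤ 2 * N + 1) ∧ ϖ ^ (-(k₀ : ℤ)) * x ∈ 𝒪[F]) := fun x hx g hg => by
    rw [← map_eq_self_and_level_iff_map_levelShift_le hc0 hc1 γ g,
      forall_valuation_sub_one_le_iff_of_hermite_companion hϖ h2 ht hD he (hF1' x hx) γ g hγ hg ht2]
    have hst := hF3st x hx g hg
    -- `2y′ + t = ϖ^{k+e} u⁻¹ x`
    have hs' : 2 * (ϖ ^ (-(-(k : ℤ) - e)) * yOf x) + t = ϖ ^ (((k + e : ℕ)) : ℤ) * (u⁻¹ * x) := by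
      have hee : (ϖ : F) ^ (((k + e : ℕ)) : ℤ) * ϖ ^ (-((k + e : ℕ) : ℤ)) = 1 := by rw [← zpow_add₀ h0, add_neg_cancel, zpow_zero]
      calc 2 * (ϖ ^ (-(-(k : ℤ) - e)) * yOf x) + t
          = (ϖ ^ (((k + e : ℕ)) : ℤ) * ϖ ^ (-((k + e : ℕ) : ℤ))) * (2 * (ϖ ^ (-(-(k : ℤ) - e)) * yOf x) + t) := by rw [hee, one_mul]
        _ = ϖ ^ (((k + e : ℕ)) : ℤ) * (ϖ ^ (-((k + e : ℕ) : ℤ)) * (2 * (ϖ ^ (-(-(k : ℤ) - e)) * yOf x) + t)) := mul_assoc _ _ _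
        _ = ϖ ^ (((k + e : ℕ)) : ℤ) * (u⁻¹ * x) := by rw [hF1 x]
    have hsv : valuation F (2 * (ϖ ^ (-(-(k : ℤ) - e)) * yOf x) + t) ≤ valuation F (ϖ ^ (((k + e + (j - e + 1) / 2 : ℕ)) : ℤ)) ↔
        ϖ ^ (-(k₀ : ℤ)) * x ∈ 𝒪[F] := by
      rw [hs', key, show (((k + e + (j - e + 1) / 2 : ℕ)) : ℤ) = ((k + e : ℕ) : ℤ) + (k₀ : ℤ) by rw [hk₀]; push_cast; ring, zpow_add₀ h0,
        map_mul, map_mul, map_mul, map_inv₀, huv, inv_one, one_mul, mul_le_mul_iff_right₀ (hpos _)]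
    rw [hsv]
    constructor
    · rintro ⟨-, h1, h2', h3⟩; exact ⟨⟨h1, h2'⟩, h3⟩
    · rintro ⟨⟨h1, h2'⟩, h3⟩; exact ⟨hst, h1, h2', h3⟩
  -- admissibility in the two currencies
  have hadm_iff : (j ≤ 2 * k + e ∧ 2 * k + e + j ≤ 2 * N + 1) ↔ (k₀ ≤ k ∧ k + j ≤ k₀ + N) := by rw [hk₀]; omega
  -- descent of `x ∈ 𝔪^{k₀}` along a congruence mod `𝔪^k` (`k₀ ≤ k`)
  have hdesc : k₀ ≤ k → ∀ a b : 𝒪[F], Ideal.Quotient.mk (maximalIdeal 𝒪[F] ^ k) a = Ideal.Quotient.mk (maximalIdeal 𝒪[F] ^ k) b →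
      ϖ ^ (-(k₀ : ℤ)) * (b : F) ∈ 𝒪[F] → ϖ ^ (-(k₀ : ℤ)) * (a : F) ∈ 𝒪[F] := fun hk₀k a b hab hb => by
    have hab' := (zpow_neg_mul_coe_sub_mem_iff_mk_eq_mk hϖ k a b).2 hab
    have : ϖ ^ (-(k₀ : ℤ)) * (a : F) = ϖ ^ (((k - k₀ : ℕ)) : ℤ) * (ϖ ^ (-(k : ℤ)) * ((a : F) - b)) + ϖ ^ (-(k₀ : ℤ)) * (b : F) := by
      rw [← mul_assoc, ← zpow_add₀ h0, show (((k - k₀ : ℕ)) : ℤ) + -(k : ℤ) = -(k₀ : ℤ) by push_cast [Nat.cast_sub hk₀k]; ring]; ring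
    rw [this]
    exact (𝒪[F]).add_mem ((𝒪[F]).mul_mem ((zpow_uniformizer_mem_integer_iff hϖ _).2 (by positivity)) hab') hb
  by_cases hadm : k₀ ≤ k ∧ k + j ≤ k₀ + N
  · -- THE BIJECTION with the anti-fixed classes of `𝔪^{k₀} ⧸ 𝔪^k`
    rw [if_pos hadm, ← natCard_antifixed_mem_pow_eq hϖ σ σO hσO' hσσ hσϖ hq ha₀ hadm.1]
    change _ = Nat.card ({x : 𝒪[F] ⧸ (maximalIdeal 𝒪[F] ^ k) |
      (Ideal.quotientMap (maximalIdeal 𝒪[F] ^ k) σO (LocalFields.UnramifiedQuadraticNorm.maximalIdeal_pow_le_comap σO hσσ k)) x = -x ∧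
        ∃ w : 𝒪[F], Ideal.Quotient.mk (maximalIdeal 𝒪[F] ^ k) w = x ∧ ϖ ^ (-(k₀ : ℤ)) * (w : F) ∈ 𝒪[F]} : Set (𝒪[F] ⧸ (maximalIdeal 𝒪[F] ^ k)))
    rw [Nat.card_coe_set_eq]
    symm
    refine Set.ncard_congr
      (fun x _ => Submodule.span 𝒪[F] (Set.range
        (!![ϖ ^ (k : ℤ), yOf (lift x); 0, ϖ ^ (-(k : ℤ) - e)] : Matrix (Fin 2) (Fin 2) F)ᵀ)) ?_ ?_ ?_
    · -- into the level-`j` part of the stratum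
      rintro x ⟨hx, w, hwx, hw⟩
      have hgx : ((Matrix.GeneralLinearGroup.mkOfDetNeZero _ (hdetT (yOf (lift x))) : GL (Fin 2) F) : Matrix (Fin 2) (Fin 2) F) =
          !![ϖ ^ (k : ℤ), yOf (lift x); 0, ϖ ^ (-(k : ℤ) - e)] := Matrix.GeneralLinearGroup.val_mkOfDetNeZero _ _
      have hlx : ϖ ^ (-(k₀ : ℤ)) * ((lift x : 𝒪[F]) : F) ∈ 𝒪[F] := hdesc hadm.1 _ _ (by rw [hlift, hwx]) hw
      exact ⟨yOf (lift x), _, hgx, (hF3sd (lift x) _ hgx).2 (by rw [hlift]; exact hx), hF3st (lift x) (lift x).2 _ hgx,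
        (hF4 (lift x) (lift x).2 _ hgx).2 ⟨hadm_iff.2 hadm, hlx⟩, by rw [hgx]⟩
    · -- injective
      intro x x' hx hx' hxx'
      have hgx : ((Matrix.GeneralLinearGroup.mkOfDetNeZero _ (hdetT (yOf (lift x))) : GL (Fin 2) F) : Matrix (Fin 2) (Fin 2) F) =
          !![ϖ ^ (k : ℤ), yOf (lift x); 0, ϖ ^ (-(k : ℤ) - e)] := Matrix.GeneralLinearGroup.val_mkOfDetNeZero _ _
      have hgx' : ((Matrix.GeneralLinearGroup.mkOfDetNeZero _ (hdetT (yOf (lift x'))) : GL (Fin 2) F) : Matrix (Fin 2) (Fin 2) F) =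
          !![ϖ ^ (k : ℤ), yOf (lift x'); 0, ϖ ^ (-(k : ℤ) - e)] := Matrix.GeneralLinearGroup.val_mkOfDetNeZero _ _
      obtain ⟨-, -, h3⟩ := (span_eq_span_iff_of_hermite hϖ _ _ hgx hgx').1 (by rw [hgx, hgx']; exact hxx')
      rw [← hlift x, ← hlift x']
      exact ((hcongr _ _).1 h3).symm
    · -- surjective
      rintro Λ ⟨y, g, hg, hsd, hst, hlev, rfl⟩
      obtain ⟨-, hyO, hnorm⟩ := (map_companion_span_eq_self_iff_of_hermite hϖ γ g hγ hd ht hg).1 hst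
      rw [(companion_rescale_identities h0 (k := k) (e := e) rfl y t d β (σ β) (σ y)).1] at hnorm
      obtain ⟨-, hz⟩ := (norm_condition_iff hϖ h2 ht hD he hyO).1 hnorm
      set z : F := ϖ ^ (-((k + e : ℕ) : ℤ)) * (2 * (ϖ ^ (-(-(k : ℤ) - e)) * y) + t) with hz'
      have hxO : u * z ∈ 𝒪[F] := (𝒪[F]).mul_mem huO hz
      have hyx : yOf (u * z) = y := by
        rw [hyOf, hz']
        have e1 : (ϖ : F) ^ (-(-(k : ℤ) - e)) = (ϖ ^ (-((k + e : ℕ) : ℤ)))⁻¹ := by rw [← _root_.zpow_neg]; congr 1; push_cast; ring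
        rw [e1]; field_simp; ring
      have hgyx : (g : Matrix (Fin 2) (Fin 2) F) = !![ϖ ^ (k : ℤ), yOf (u * z); 0, ϖ ^ (-(k : ℤ) - e)] := by rw [hg, hyx]
      refine ⟨Ideal.Quotient.mk (maximalIdeal 𝒪[F] ^ k) ⟨_, hxO⟩, ⟨?_, ⟨_, hxO⟩, rfl, ((hF4 (u * z) hxO g hgyx).1 hlev).2⟩, ?_⟩
      · -- anti-fixed, from self-duality
        exact (hF3sd ⟨_, hxO⟩ g hgyx).1 hsd
      · -- the same lattice
        have hgx : ((Matrix.GeneralLinearGroup.mkOfDetNeZero _ (hdetT (yOf (lift (Ideal.Quotient.mk (maximalIdeal 𝒪[F] ^ k) ⟨_, hxO⟩)))) :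
            GL (Fin 2) F) : Matrix (Fin 2) (Fin 2) F) = !![ϖ ^ (k : ℤ), yOf (lift (Ideal.Quotient.mk (maximalIdeal 𝒪[F] ^ k) ⟨_, hxO⟩)); 0, ϖ ^ (-(k : ℤ) - e)] :=
          Matrix.GeneralLinearGroup.val_mkOfDetNeZero _ _
        rw [← hgx]
        refine span_eq_span_of_hermite_of_sub_mem hϖ _ g hgx hg ?_
        rw [show y = yOf ((⟨u * z, hxO⟩ : 𝒪[F]) : F) from hyx.symm]
        exact (hcongr _ _).2 (hlift _).symm
  · -- EMPTY: a member forces admissibility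
    rw [if_neg hadm]
    have hempty : ∀ S : Set (Submodule 𝒪[F] (Fin 2 → F)), (∀ Λ, Λ ∉ S) → S.ncard = 0 := fun S hS => by
      rw [Set.eq_empty_of_forall_notMem hS, Set.ncard_empty]
    refine hempty _ fun Λ hΛ => hadm ?_
    obtain ⟨y, g, hg, -, hst, hlev, -⟩ := hΛ
    obtain ⟨-, hyO, -⟩ := (map_companion_span_eq_self_iff_of_hermite hϖ γ g hγ hd ht hg).1 hst
    obtain ⟨-, hent⟩ := (map_eq_self_and_level_iff_map_levelShift_le hc0 hc1 γ g).2 hlev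
    obtain ⟨h1, h2', -⟩ := (forall_valuation_sub_one_le_iff_of_hermite_companion hϖ h2 ht hD he hyO γ g hγ hg ht2).1 hent
    exact hadm_iff.1 ⟨h1, h2'⟩

/-! ## §2 The total level-`j` count -/

include hϖ hσO' hσσ hσϖ hσv h2 ht hd he hβ hD htr hγ hj hjN ht2 in
/-- **THE LEVEL-`j` COUNT** `#S_j(!![0, β; σβ, 0], C(t,d)) = Σ_{i=0}^{N−j} q^i` (`= phiHtwo q (N − j)`): the number of self-dual `C`-stable lattices on which `C` acts
at level `j`, for `γ = C(t, d)` deep (`|t − 2| ≤ |ϖ^j|`, `1 ≤ j ≤ N`) — law C1 on the type-(2) torus. [cite: Flicker1998UnitaryFL, §6 p. 97] [cite: Rogawski1990, §4.9] -/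
theorem ncard_selfDualStable_level_antidiag_companion_eq_sum {q : ℕ} [Finite (ResidueField 𝒪[F])]
    (hq : Nat.card (ResidueField 𝒪[F]) = q ^ 2) {a₀ : 𝒪[F]} (ha₀ : IsUnit (σO a₀ - a₀)) :
    {Λ : Submodule 𝒪[F] (Fin 2 → F) |
        (∃ g : GL (Fin 2) F, (∃ J' ∈ glInt 2 F, (J' : Matrix (Fin 2) (Fin 2) F) = formCongr σ g (!![0, β; σ β, 0] : Matrix (Fin 2) (Fin 2) F)) ∧
          Λ = Submodule.span 𝒪[F] (Set.range ((g : Matrix (Fin 2) (Fin 2) F))ᵀ)) ∧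
        Λ.map ((Matrix.toLin' (γ : Matrix (Fin 2) (Fin 2) F)).restrictScalars 𝒪[F]) = Λ ∧
        Λ.map ((Matrix.toLin' (1 + (ϖ ^ j)⁻¹ • ((γ : Matrix (Fin 2) (Fin 2) F) - 1))).restrictScalars 𝒪[F]) ≤ Λ}.ncard =
      ∑ i ∈ Finset.range (N - j + 1), q ^ i := by
  classical
  have h0 := hϖ.ne_zero
  have hσO : ∀ x : 𝒪[F], σ x ∈ 𝒪[F] := fun x => by rw [← hσO' x]; exact (σO x).2
  set k₀ : ℕ := (j - e + 1) / 2 with hk₀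
  -- the level-`j` parts of the strata, and the strata
  set T : ℕ → Set (Submodule 𝒪[F] (Fin 2 → F)) := fun k =>
    {Λ | ∃ (y : F) (g : GL (Fin 2) F), (g : Matrix (Fin 2) (Fin 2) F) = !![ϖ ^ (k : ℤ), y; 0, ϖ ^ (-(k : ℤ) - e)] ∧
        (∃ J' ∈ glInt 2 F, (J' : Matrix (Fin 2) (Fin 2) F) = formCongr σ g (!![0, β; σ β, 0] : Matrix (Fin 2) (Fin 2) F)) ∧
        (Submodule.span 𝒪[F] (Set.range ((g : Matrix (Fin 2) (Fin 2) F))ᵀ)).map ((Matrix.toLin' (γ : Matrix (Fin 2) (Fin 2) F)).restrictScalars 𝒪[F]) =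
          Submodule.span 𝒪[F] (Set.range ((g : Matrix (Fin 2) (Fin 2) F))ᵀ) ∧
        (Submodule.span 𝒪[F] (Set.range ((g : Matrix (Fin 2) (Fin 2) F))ᵀ)).map
            ((Matrix.toLin' (1 + (ϖ ^ j)⁻¹ • ((γ : Matrix (Fin 2) (Fin 2) F) - 1))).restrictScalars 𝒪[F]) ≤
          Submodule.span 𝒪[F] (Set.range ((g : Matrix (Fin 2) (Fin 2) F))ᵀ) ∧
        Λ = Submodule.span 𝒪[F] (Set.range ((g : Matrix (Fin 2) (Fin 2) F))ᵀ)} with hT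
  set T₀ : ℕ → Set (Submodule 𝒪[F] (Fin 2 → F)) := fun k =>
    {Λ | ∃ (y : F) (g : GL (Fin 2) F), (g : Matrix (Fin 2) (Fin 2) F) = !![ϖ ^ (k : ℤ), y; 0, ϖ ^ (-(k : ℤ) - e)] ∧
        (∃ J' ∈ glInt 2 F, (J' : Matrix (Fin 2) (Fin 2) F) = formCongr σ g (!![0, β; σ β, 0] : Matrix (Fin 2) (Fin 2) F)) ∧
        (Submodule.span 𝒪[F] (Set.range ((g : Matrix (Fin 2) (Fin 2) F))ᵀ)).map ((Matrix.toLin' (γ : Matrix (Fin 2) (Fin 2) F)).restrictScalars 𝒪[F]) =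
          Submodule.span 𝒪[F] (Set.range ((g : Matrix (Fin 2) (Fin 2) F))ᵀ) ∧
        Λ = Submodule.span 𝒪[F] (Set.range ((g : Matrix (Fin 2) (Fin 2) F))ᵀ)} with hT₀
  have hq1 : 1 ≤ q := by
    rcases Nat.eq_zero_or_pos q with rfl | h
    · rw [zero_pow two_ne_zero] at hq; exact absurd hq (Nat.card_pos (α := ResidueField 𝒪[F])).ne'
    · exact h
  have hval : ∀ k ∈ range (N + 1), (T k).ncard = if k₀ ≤ k ∧ k + j ≤ k₀ + N then q ^ (k - k₀) else 0 := fun k hk => by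
    rw [hT]
    exact ncard_stratum_level_antidiag_companion_eq hϖ σ σO hσO' hσσ hσϖ hσv h2 ht hd he hβ hD htr γ hγ hj ht2 hq ha₀
      (Nat.lt_succ_iff.1 (Finset.mem_range.1 hk))
  have hfin₀ : ∀ k ∈ range (N + 1), (T₀ k).Finite := fun k hk => by
    refine Set.finite_of_ncard_ne_zero (s := T₀ k) ?_
    rw [hT₀, (ncard_stratum_antidiag_companion_eq_natCard_antifixed hϖ σ σO hσO' hσσ hσϖ hσv h2 ht hd he hβ hD htr γ hγ
      (Nat.lt_succ_iff.1 (Finset.mem_range.1 hk))), LocalFields.UnramifiedQuadraticNorm.natCard_antifixed_quotient_pow σO hσσ ha₀ hq k]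
    exact pow_ne_zero _ (by omega)
  have hfin : ∀ k ∈ range (N + 1), (T k).Finite := fun k hk => by
    refine (hfin₀ k hk).subset ?_
    rw [hT, hT₀]
    rintro Λ ⟨y, g, hg, hsd, hst, -, hΛ⟩
    exact ⟨y, g, hg, hsd, hst, hΛ⟩
  set U : Finset (Submodule 𝒪[F] (Fin 2 → F)) := (range (N + 1)).attach.biUnion fun k => (hfin k.1 k.2).toFinset with hU
  have hSU : {Λ : Submodule 𝒪[F] (Fin 2 → F) |
        (∃ g : GL (Fin 2) F, (∃ J' ∈ glInt 2 F, (J' : Matrix (Fin 2) (Fin 2) F) = formCongr σ g (!![0, β; σ β, 0] : Matrix (Fin 2) (Fin 2) F)) ∧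
          Λ = Submodule.span 𝒪[F] (Set.range ((g : Matrix (Fin 2) (Fin 2) F))ᵀ)) ∧
        Λ.map ((Matrix.toLin' (γ : Matrix (Fin 2) (Fin 2) F)).restrictScalars 𝒪[F]) = Λ ∧
        Λ.map ((Matrix.toLin' (1 + (ϖ ^ j)⁻¹ • ((γ : Matrix (Fin 2) (Fin 2) F) - 1))).restrictScalars 𝒪[F]) ≤ Λ} =
      (U : Set (Submodule 𝒪[F] (Fin 2 → F))) := by
    ext Λ
    have hmem := mem_selfDualStable_antidiag_companion_iff hϖ σ hσϖ hσv hσO h2 ht hd he hβ hD γ hγ Λ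
    simp only [Set.mem_setOf_eq] at hmem ⊢
    rw [hU, Finset.coe_biUnion]
    simp only [Finset.mem_coe, Finset.mem_attach, Set.iUnion_true, Set.mem_iUnion, Set.Finite.coe_toFinset]
    constructor
    · rintro ⟨hsd, hst, hlev⟩
      obtain ⟨k, hk, y, g, hg, hsd', hst', hΛ⟩ := hmem.1 ⟨hsd, hst⟩
      refine ⟨⟨k, Finset.mem_range.2 (Nat.lt_succ_of_le hk)⟩, ?_⟩
      rw [hT]; exact ⟨y, g, hg, hsd', hst', by rw [← hΛ]; exact hlev, hΛ⟩
    · rintro ⟨⟨k, hk⟩, hmemT⟩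
      rw [hT] at hmemT
      obtain ⟨y, g, hg, hsd, hst, hlev, hΛ⟩ := hmemT
      obtain ⟨hsd', hst'⟩ := hmem.2 ⟨k, Nat.lt_succ_iff.1 (Finset.mem_range.1 hk), y, g, hg, hsd, hst, hΛ⟩
      exact ⟨hsd', hst', by rw [hΛ]; exact hlev⟩
  have hdisj : (↑(range (N + 1)).attach : Set {k // k ∈ range (N + 1)}).PairwiseDisjoint fun k => (hfin k.1 k.2).toFinset := by
    rintro ⟨k, hk⟩ - ⟨k', hk'⟩ - hne
    rw [Function.onFun, Set.Finite.disjoint_toFinset, Set.disjoint_left]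
    rintro Λ hΛ hΛ'
    rw [hT] at hΛ hΛ'
    obtain ⟨y, g, hg, -, -, -, hΛg⟩ := hΛ
    obtain ⟨y', g', hg', -, -, -, hΛg'⟩ := hΛ'
    have h1 := ((span_eq_span_iff_of_hermite hϖ g g' hg hg').1 (hΛg.symm.trans hΛg')).1
    exact hne (Subtype.ext (by exact_mod_cast h1))
  rw [hSU, Set.ncard_coe_finset, hU, Finset.card_biUnion hdisj, ← Finset.sum_attach (range (N - j + 1))]
  -- `Σ_{k ≤ N} [k₀ ≤ k ≤ k₀ + N − j] q^{k − k₀} = Σ_{i ≤ N − j} q^i`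
  have hk₀j : k₀ ≤ j := by rw [hk₀]; omega
  calc ∑ k ∈ (range (N + 1)).attach, ((hfin k.1 k.2).toFinset).card
      = ∑ k ∈ (range (N + 1)).attach, (if k₀ ≤ k.1 ∧ k.1 + j ≤ k₀ + N then q ^ (k.1 - k₀) else 0) := by
        refine Finset.sum_congr rfl fun k _ => ?_
        rw [← Set.ncard_eq_toFinset_card _ (hfin k.1 k.2), hval k.1 k.2]
    _ = ∑ k ∈ range (N + 1), (if k₀ ≤ k ∧ k + j ≤ k₀ + N then q ^ (k - k₀) else 0) :=
        Finset.sum_attach (range (N + 1)) (fun k => if k₀ ≤ k ∧ k + j ≤ k₀ + N then q ^ (k - k₀) else 0)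
    _ = ∑ i ∈ range (N - j + 1), q ^ i := by
        rw [Finset.sum_ite, Finset.sum_const_zero, add_zero]
        refine Finset.sum_nbij' (fun k => k - k₀) (fun i => i + k₀) ?_ ?_ ?_ ?_ ?_
        · intro k hk
          simp only [Finset.mem_filter, Finset.mem_range] at hk
          simp only [Finset.mem_range]; omega
        · intro i hi
          simp only [Finset.mem_range] at hi
          simp only [Finset.mem_filter, Finset.mem_range]; omega
        · intro k hk
          simp only [Finset.mem_filter, Finset.mem_range] at hk
          omega
        · intro i _; omega
        · intro k _; rfl
    _ = ∑ i ∈ (range (N - j + 1)).attach, q ^ (i : ℕ) := (Finset.sum_attach (range (N - j + 1)) (fun i => q ^ i)).symm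

end Literature.NumberTheory.Automorphic

end
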